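import Mathlib
import HarnessLib

/-!
# Ford–Green–Konyagin–Maynard–Tao 2018 — Lemma 6.1: the product law of the random sifted set
# `S(a⃗)` for uniform residues (PROVED)

Topic `Literature/NumberTheory/Sieve`. Source: K. Ford, B. Green, S. Konyagin, J. Maynard, T. Tao,
*Long gaps between primes*, J. Amer. Math. Soc. 31 (2018) 65–105 = arXiv:1412.5029, §6 pp. 17–18,
Lemma 6.1 and its proof [FordGreenKonyaginMaynardTao2018].

Setting (p. 17): `𝒮` a finite set of moduli (in the paper: the primes `s ∈ (log^{20} x, z]`), the
residue vector `a⃗ = (a_s mod s)_{s ∈ 𝒮}` chosen UNIFORMLY from the finite box `∏_{s ∈ 𝒮} ℤ/sℤ`, and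
`S(a⃗) = {n ∈ ℤ : n ≢ a_s (mod s) for all s ∈ 𝒮}` the random sifted set. Lemma 6.1 states
`P(n_1, …, n_t ∈ S(a⃗)) = (1 + O(log^{-16} x)) σ^t`, `σ = ∏_{s ∈ 𝒮} (1 − 1/s)`, for distinct
integers `n_i = O(x^{O(1)})`, `t ≤ log x`. Everything here is PROVED and EXACT/finite; the
asymptotic instantiation (with `s ≥ log^{20} x`) is left to the deduction «Theorem 5 ⇒ Theorem 4»:

* `FGKMT2018.siftProb_eq_prod` — the EXACT law (independence in `s`, first display of the proof on
  p. 18): `P(T ⊆ S(a⃗)) = ∏_{s ∈ 𝒮} (1 − t_s / s)` where `t_s = #{n mod s : n ∈ T}`;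
* `FGKMT2018.card_hitRes_le`, `card_hitRes_eq_card` — `t_s ≤ #T`, with equality unless `s` divides a
  difference `n − n'` of two elements of `T` («occupy t distinct residue classes modulo s, unless s
  divides one of n_i − n_j»);
* `FGKMT2018.prod_le_siftProb`, `siftProb_le_prod_sdiff` — the two-sided bound
  `∏_{s ∈ 𝒮} (1 − #T/s) ≤ P(T ⊆ S(a⃗)) ≤ ∏_{s ∈ 𝒮 ∖ B} (1 − #T/s)`, `B` = the exceptional moduli;
* `FGKMT2018.card_primeFactors_ge_le`, `card_exceptional_le` — `#B ≤ #T² log M / log s₀` when the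
  moduli are primes `≥ s₀` and the differences are `≤ M` in absolute value («occurs at most
  O(t² log x) times»);
* `FGKMT2018.prod_one_sub_div_le_pow`, `pow_le_prod_one_sub_div_mul_exp`,
  `one_sub_le_prod_exceptional` — the comparison `∏ (1 − t/s)` vs `σ^t = ∏ (1 − 1/s)^t` (last two
  displays of the proof: `(1 − 1/s)^t = (1 − t/s)(1 + O(t²/s²))`) and the Weierstrass product
  inequality used to control `∏_{s ∈ B}`.

The residue vector is also provided as a total function `FGKMT2018.extendRes S f : ℕ → ℕ`, the format
of the `a : ℕ → ℕ` in `FGKMT2018.sievedQ` / `FordGreenKonyaginMaynardTao2018_theorem4`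
(`FGKMT2018RandomConstruction.lean`), with `FGKMT2018.sifts_extendRes_iff`.
-/

noncomputable section

open Finset

namespace Literature.NumberTheory.Sieve

namespace FGKMT2018

/-! ### The box of residue vectors and the sifted event -/

/-- The box `∏_{s ∈ S} {0, …, s − 1}` of residue vectors `a⃗ = (a_s)_{s ∈ S}`, as dependent functions
on `S`; the uniform probability on it is the counting measure divided by `∏_{s ∈ S} s`.
[cite: FordGreenKonyaginMaynardTao2018, §6 p. 17 «selecting each a_s mod s uniformly at random from
ℤ/sℤ, independently in s»] -/
def residueBox (S : Finset ℕ) : Finset ((s : ℕ) → s ∈ S → ℕ) :=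
  S.pi fun s => Finset.range s

/-- [cite: FordGreenKonyaginMaynardTao2018, §6 p. 17] -/
theorem card_residueBox (S : Finset ℕ) : #(residueBox S) = ∏ s ∈ S, s := by
  simp [residueBox, Finset.card_pi]

/-- The residue vector `f` of the box as a total function `ℕ → ℕ` (value `0` off `S`), the format of
the argument `a` of `FGKMT2018.sievedQ`. [cite: FordGreenKonyaginMaynardTao2018, §6 p. 17] -/
def extendRes (S : Finset ℕ) (f : (s : ℕ) → s ∈ S → ℕ) : ℕ → ℕ :=
  fun s => if h : s ∈ S then f s h else 0

/-- [cite: FordGreenKonyaginMaynardTao2018, §6 p. 17] -/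
theorem extendRes_apply {S : Finset ℕ} (f : (s : ℕ) → s ∈ S → ℕ) {s : ℕ} (h : s ∈ S) :
    extendRes S f s = f s h := by
  simp [extendRes, h]

/-- The event `T ⊆ S(a⃗)` for a residue vector given as a total function `a : ℕ → ℕ`:
no `n ∈ T` is `≡ a_s (mod s)` for any `s ∈ S` (cf. `S(a⃗)` in (1.x)/(3.x) of the paper and
`FGKMT2018.sievedQ`). [cite: FordGreenKonyaginMaynardTao2018, §3 p. 8 and §6 p. 17] -/
def Sifts (S : Finset ℕ) (a : ℕ → ℕ) (T : Finset ℤ) : Prop :=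
  ∀ s ∈ S, ∀ n ∈ T, ¬ n ≡ (a s : ℤ) [ZMOD (s : ℤ)]

/-- [cite: FordGreenKonyaginMaynardTao2018, §6 p. 17] -/
theorem sifts_extendRes_iff {S : Finset ℕ} (f : (s : ℕ) → s ∈ S → ℕ) (T : Finset ℤ) :
    Sifts S (extendRes S f) T ↔ ∀ s (h : s ∈ S), ∀ n ∈ T, ¬ n ≡ (f s h : ℤ) [ZMOD (s : ℤ)] := by
  refine ⟨fun H s h n hn => ?_, fun H s h n hn => ?_⟩
  · have := H s h n hn
    rwa [extendRes_apply f h] at this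
  · rw [extendRes_apply f h]
    exact H s h n hn

/-- The number of residue vectors of the box that sift out no element of `T`
(`#{a⃗ : T ⊆ S(a⃗)}`). [cite: FordGreenKonyaginMaynardTao2018, Lemma 6.1 (p. 17)] -/
def siftCount (S : Finset ℕ) (T : Finset ℤ) : ℕ :=
  #((residueBox S).filter fun f => ∀ s (h : s ∈ S), ∀ n ∈ T, ¬ n ≡ (f s h : ℤ) [ZMOD (s : ℤ)])

/-- `P(T ⊆ S(a⃗)) = P(n ∈ S(a⃗) for all n ∈ T)` for `a⃗` uniform on the residue box.
[cite: FordGreenKonyaginMaynardTao2018, Lemma 6.1 (p. 17)] -/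
def siftProb (S : Finset ℕ) (T : Finset ℤ) : ℝ :=
  (siftCount S T : ℝ) / ∏ s ∈ S, (s : ℝ)

/-- The residues modulo `s` hit by `T`: `{n mod s : n ∈ T} ⊆ [0, s)`.
[cite: FordGreenKonyaginMaynardTao2018, Lemma 6.1 (proof, p. 18)] -/
def hitRes (s : ℕ) (T : Finset ℤ) : Finset ℤ :=
  T.image fun n => n % (s : ℤ)

/-- The good residues modulo `s`: `a ∈ [0, s)` with `n ≢ a (mod s)` for all `n ∈ T`.
[cite: FordGreenKonyaginMaynardTao2018, Lemma 6.1 (proof, p. 18)] -/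
def goodRes (s : ℕ) (T : Finset ℤ) : Finset ℕ :=
  (Finset.range s).filter fun a => ∀ n ∈ T, ¬ n ≡ (a : ℤ) [ZMOD (s : ℤ)]

/-! ### Independence in `s`: the count factorises -/

/-- The sifting event is a product event: `{a⃗ : T ⊆ S(a⃗)} = ∏_{s ∈ S} (good residues mod s)`,
hence `#{a⃗ : T ⊆ S(a⃗)} = ∏_{s ∈ S} #goodRes`.
[cite: FordGreenKonyaginMaynardTao2018, Lemma 6.1 (proof, p. 18: independence in s)] -/
theorem siftCount_eq_prod (S : Finset ℕ) (T : Finset ℤ) :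
    siftCount S T = ∏ s ∈ S, #(goodRes s T) := by
  rw [siftCount, ← Finset.card_pi]
  congr 1
  ext f
  simp only [residueBox, goodRes, Finset.mem_filter, Finset.mem_pi, Finset.mem_range]
  constructor
  · rintro ⟨h1, h2⟩ s hs
    exact ⟨h1 s hs, h2 s hs⟩
  · intro h
    exact ⟨fun s hs => (h s hs).1, fun s hs => (h s hs).2⟩

/-- Modulo `s ≥ 1`, the residues `a ∈ [0, s)` congruent to some `n ∈ T` are exactly the `t_s`
hit residues: `#goodRes + t_s = s`. [cite: FordGreenKonyaginMaynardTao2018, Lemma 6.1 (proof, p. 18: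
«the probability that a_s mod s avoids all of the n_i is 1 − t/s»)] -/
theorem card_goodRes_add_card_hitRes {s : ℕ} (hs : 0 < s) (T : Finset ℤ) :
    #(goodRes s T) + #(hitRes s T) = s := by
  have hs' : (0 : ℤ) < s := by exact_mod_cast hs
  -- the bad residues
  set bad : Finset ℕ := (Finset.range s).filter fun a => ¬ ∀ n ∈ T, ¬ n ≡ (a : ℤ) [ZMOD (s : ℤ)]
    with hbad
  have hsplit : #(goodRes s T) + #bad = s := by
    rw [goodRes, hbad, Finset.card_filter_add_card_filter_not, Finset.card_range]
  have himage : bad.image (fun a : ℕ => (a : ℤ)) = hitRes s T := by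
    ext z
    simp only [hbad, hitRes, Finset.mem_image, Finset.mem_filter, Finset.mem_range, not_forall,
      not_not, exists_prop]
    constructor
    · rintro ⟨a, ⟨ha, n, hn, hna⟩, rfl⟩
      refine ⟨n, hn, ?_⟩
      rw [hna]
      exact Int.emod_eq_of_lt (by positivity) (by exact_mod_cast ha)
    · rintro ⟨n, hn, rfl⟩
      have h0 : 0 ≤ n % (s : ℤ) := Int.emod_nonneg _ hs'.ne'
      have h1 : n % (s : ℤ) < s := Int.emod_lt_of_pos _ hs'
      refine ⟨(n % (s : ℤ)).toNat, ⟨?_, n, hn, ?_⟩, Int.toNat_of_nonneg h0⟩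
      · have : ((n % (s : ℤ)).toNat : ℤ) < s := by rwa [Int.toNat_of_nonneg h0]
        exact_mod_cast this
      · rw [Int.toNat_of_nonneg h0, Int.ModEq, Int.emod_emod_of_dvd _ dvd_rfl]
  have hcard : #bad = #(hitRes s T) := by
    rw [← himage, Finset.card_image_of_injective _ (fun a b h => by exact_mod_cast h)]
  omega

/-- `t_s ≤ #T`. [cite: FordGreenKonyaginMaynardTao2018, Lemma 6.1 (proof, p. 18)] -/
theorem card_hitRes_le (s : ℕ) (T : Finset ℤ) : #(hitRes s T) ≤ #T :=
  Finset.card_image_le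

/-- `t_s ≤ s` for `s ≥ 1`. [cite: FordGreenKonyaginMaynardTao2018, Lemma 6.1 (proof, p. 18)] -/
theorem card_hitRes_le_modulus {s : ℕ} (hs : 0 < s) (T : Finset ℤ) : #(hitRes s T) ≤ s := by
  have := card_goodRes_add_card_hitRes hs T
  omega

/-- `t_s = #T` as soon as `s` divides no difference of two distinct elements of `T` («occupy t
distinct residue classes modulo s, unless s divides one of n_i − n_j»).
[cite: FordGreenKonyaginMaynardTao2018, Lemma 6.1 (proof, p. 18)] -/
theorem card_hitRes_eq_card {s : ℕ} {T : Finset ℤ}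
    (h : ∀ n ∈ T, ∀ n' ∈ T, n ≠ n' → ¬ (s : ℤ) ∣ n - n') : #(hitRes s T) = #T := by
  rw [hitRes, Finset.card_image_of_injOn]
  intro n hn n' hn' hnn'
  by_contra hne
  have hmod : n' ≡ n [ZMOD (s : ℤ)] := hnn'.symm
  exact h n hn n' hn' hne hmod.dvd

/-! ### The exact law and the two-sided bound -/

/-- **Lemma 6.1, exact form.** For `a⃗` uniform on `∏_{s ∈ S} ℤ/sℤ` (all `s ≥ 1`),
`P(T ⊆ S(a⃗)) = ∏_{s ∈ S} (1 − t_s / s)` with `t_s = #{n mod s : n ∈ T}`.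
[cite: FordGreenKonyaginMaynardTao2018, Lemma 6.1 (proof, p. 18, first display)] -/
theorem siftProb_eq_prod {S : Finset ℕ} (hS : ∀ s ∈ S, 0 < s) (T : Finset ℤ) :
    siftProb S T = ∏ s ∈ S, (1 - (#(hitRes s T) : ℝ) / s) := by
  rw [siftProb, siftCount_eq_prod, Nat.cast_prod, ← Finset.prod_div_distrib]
  refine Finset.prod_congr rfl fun s hs => ?_
  have hs0 : (s : ℝ) ≠ 0 := by exact_mod_cast (hS s hs).ne'
  have h := card_goodRes_add_card_hitRes (hS s hs) T
  have h' : (#(goodRes s T) : ℝ) = s - #(hitRes s T) := by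
    have : (#(goodRes s T) : ℝ) + #(hitRes s T) = s := by exact_mod_cast h
    linarith
  rw [h']
  field_simp

/-- `0 ≤ P(T ⊆ S(a⃗))`. [cite: FordGreenKonyaginMaynardTao2018, Lemma 6.1 (p. 17)] -/
theorem siftProb_nonneg (S : Finset ℕ) (T : Finset ℤ) : 0 ≤ siftProb S T :=
  div_nonneg (Nat.cast_nonneg _) (Finset.prod_nonneg fun s _ => Nat.cast_nonneg s)

/-- Lower bound: `∏_{s ∈ S} (1 − #T/s) ≤ P(T ⊆ S(a⃗))` (when `#T ≤ s` for all moduli, so that all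
factors are non-negative). [cite: FordGreenKonyaginMaynardTao2018, Lemma 6.1 (proof, p. 18)] -/
theorem prod_le_siftProb {S : Finset ℕ} (hS : ∀ s ∈ S, 0 < s) {T : Finset ℤ}
    (hT : ∀ s ∈ S, #T ≤ s) :
    ∏ s ∈ S, (1 - (#T : ℝ) / s) ≤ siftProb S T := by
  rw [siftProb_eq_prod hS]
  refine Finset.prod_le_prod (fun s hs => ?_) (fun s hs => ?_)
  · have hs0 : (0 : ℝ) < s := by exact_mod_cast hS s hs
    rw [sub_nonneg, div_le_one hs0]
    exact_mod_cast hT s hs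
  · have hs0 : (0 : ℝ) < s := by exact_mod_cast hS s hs
    have : (#(hitRes s T) : ℝ) ≤ #T := by exact_mod_cast card_hitRes_le s T
    gcongr

/-- The exceptional moduli of `T`: those `s ∈ S` dividing a difference of two distinct elements of
`T`. [cite: FordGreenKonyaginMaynardTao2018, Lemma 6.1 (proof, p. 18)] -/
def exceptional (S : Finset ℕ) (T : Finset ℤ) : Finset ℕ :=
  S.filter fun s => ∃ n ∈ T, ∃ n' ∈ T, n ≠ n' ∧ (s : ℤ) ∣ n - n'

/-- [cite: FordGreenKonyaginMaynardTao2018, Lemma 6.1 (proof, p. 18)] -/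
theorem exceptional_subset (S : Finset ℕ) (T : Finset ℤ) : exceptional S T ⊆ S :=
  Finset.filter_subset _ _

/-- Upper bound: `P(T ⊆ S(a⃗)) ≤ ∏_{s ∈ S ∖ B} (1 − #T/s)`, `B` the exceptional moduli (the factors
at `s ∈ B` are in `[0, 1]` and are discarded; at `s ∉ B` one has `t_s = #T`).
[cite: FordGreenKonyaginMaynardTao2018, Lemma 6.1 (proof, p. 18)] -/
theorem siftProb_le_prod_sdiff {S : Finset ℕ} (hS : ∀ s ∈ S, 0 < s) (T : Finset ℤ) :
    siftProb S T ≤ ∏ s ∈ S \ exceptional S T, (1 - (#T : ℝ) / s) := by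
  rw [siftProb_eq_prod hS, ← Finset.prod_sdiff (exceptional_subset S T)]
  have h1 : ∏ s ∈ S \ exceptional S T, (1 - (#(hitRes s T) : ℝ) / s) =
      ∏ s ∈ S \ exceptional S T, (1 - (#T : ℝ) / s) := by
    refine Finset.prod_congr rfl fun s hs => ?_
    rw [Finset.mem_sdiff] at hs
    have hns : s ∉ exceptional S T := hs.2
    rw [card_hitRes_eq_card]
    intro n hn n' hn' hne hdvd
    exact hns (Finset.mem_filter.2 ⟨hs.1, n, hn, n', hn', hne, hdvd⟩)
  have h2 : ∏ s ∈ exceptional S T, (1 - (#(hitRes s T) : ℝ) / s) ≤ 1 := by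
    refine Finset.prod_le_one (fun s hs => ?_) (fun s hs => ?_)
    · have hsS : s ∈ S := exceptional_subset S T hs
      have hs0 : (0 : ℝ) < s := by exact_mod_cast hS s hsS
      rw [sub_nonneg, div_le_one hs0]
      exact_mod_cast card_hitRes_le_modulus (hS s hsS) T
    · have : (0 : ℝ) ≤ (#(hitRes s T) : ℝ) / s := by positivity
      linarith
  have h0 : 0 ≤ ∏ s ∈ S \ exceptional S T, (1 - (#(hitRes s T) : ℝ) / s) := by
    refine Finset.prod_nonneg fun s hs => ?_
    have hsS : s ∈ S := (Finset.mem_sdiff.1 hs).1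
    have hs0 : (0 : ℝ) < s := by exact_mod_cast hS s hsS
    rw [sub_nonneg, div_le_one hs0]
    exact_mod_cast card_hitRes_le_modulus (hS s hsS) T
  calc (∏ s ∈ S \ exceptional S T, (1 - (#(hitRes s T) : ℝ) / s)) *
        ∏ s ∈ exceptional S T, (1 - (#(hitRes s T) : ℝ) / s)
      ≤ (∏ s ∈ S \ exceptional S T, (1 - (#(hitRes s T) : ℝ) / s)) * 1 :=
        mul_le_mul_of_nonneg_left h2 h0
    _ = ∏ s ∈ S \ exceptional S T, (1 - (#T : ℝ) / s) := by rw [mul_one, h1]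

/-! ### Few exceptional moduli -/

/-- A non-zero natural number `D` has at most `log D / log s₀` prime factors `≥ s₀ ≥ 2` in `S`
(`s₀^{#} ≤ ∏ ≤ D`). [cite: FordGreenKonyaginMaynardTao2018, Lemma 6.1 (proof, p. 18: «since
s ≥ log^{20} x and the n_i − n_j are of size O(x^{O(1)}), … at most O(t² log x) times»)] -/
theorem card_primeFactors_ge_le {S : Finset ℕ} (hS : ∀ s ∈ S, s.Prime) {s₀ : ℕ} (hs₀ : 2 ≤ s₀)
    (hSs₀ : ∀ s ∈ S, s₀ ≤ s) {D : ℕ} (hD : D ≠ 0) :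
    (#(S.filter (· ∣ D)) : ℝ) ≤ Real.log D / Real.log s₀ := by
  have hprod : ∏ s ∈ S.filter (· ∣ D), s ∣ D :=
    Finset.prod_primes_dvd D (fun s hs => Nat.prime_iff.1 (hS s (Finset.mem_filter.1 hs).1))
      (fun s hs => (Finset.mem_filter.1 hs).2)
  have hle : s₀ ^ #(S.filter (· ∣ D)) ≤ D :=
    (Finset.pow_card_le_prod _ _ _ (fun s hs => hSs₀ s (Finset.mem_filter.1 hs).1)).trans
      (Nat.le_of_dvd (Nat.pos_of_ne_zero hD) hprod)
  have hs₀' : (1 : ℝ) < s₀ := by exact_mod_cast hs₀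
  have hlog : 0 < Real.log s₀ := Real.log_pos hs₀'
  rw [le_div_iff₀ hlog, ← Real.log_pow]
  refine Real.log_le_log (by positivity) ?_
  exact_mod_cast hle

/-- The number of exceptional moduli is at most `#T² · log M / log s₀` when the moduli are primes
`≥ s₀ ≥ 2` and all differences of elements of `T` are at most `M ≥ 1` in absolute value.
[cite: FordGreenKonyaginMaynardTao2018, Lemma 6.1 (proof, p. 18: «occurs at most O(t² log x)
times»)] -/
theorem card_exceptional_le {S : Finset ℕ} (hS : ∀ s ∈ S, s.Prime) {s₀ : ℕ} (hs₀ : 2 ≤ s₀)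
    (hSs₀ : ∀ s ∈ S, s₀ ≤ s) {T : Finset ℤ} {M : ℝ} (hM1 : 1 ≤ M)
    (hM : ∀ n ∈ T, ∀ n' ∈ T, (|n - n'| : ℝ) ≤ M) :
    (#(exceptional S T) : ℝ) ≤ (#T : ℝ) ^ 2 * (Real.log M / Real.log s₀) := by
  classical
  have hs₀' : (1 : ℝ) < s₀ := by exact_mod_cast hs₀
  have hlog : 0 < Real.log s₀ := Real.log_pos hs₀'
  have hq : 0 ≤ Real.log M / Real.log s₀ := div_nonneg (Real.log_nonneg hM1) hlog.le
  -- `B ⊆ ⋃_{(n, n') ∈ T.offDiag} {s ∈ S : s ∣ |n − n'|}`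
  have hsub : exceptional S T ⊆
      T.offDiag.biUnion fun p => S.filter (· ∣ (p.1 - p.2).natAbs) := by
    intro s hs
    obtain ⟨hsS, n, hn, n', hn', hne, hdvd⟩ := Finset.mem_filter.1 hs
    refine Finset.mem_biUnion.2 ⟨(n, n'), Finset.mem_offDiag.2 ⟨hn, hn', hne⟩, ?_⟩
    refine Finset.mem_filter.2 ⟨hsS, ?_⟩
    exact Int.natCast_dvd.1 hdvd
  have hterm : ∀ p ∈ T.offDiag,
      (#(S.filter (· ∣ (p.1 - p.2).natAbs)) : ℝ) ≤ Real.log M / Real.log s₀ := by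
    intro p hp
    obtain ⟨h1, h2, hne⟩ := Finset.mem_offDiag.1 hp
    have hD : (p.1 - p.2).natAbs ≠ 0 := by
      rw [Ne, Int.natAbs_eq_zero, sub_eq_zero]
      exact hne
    refine (card_primeFactors_ge_le hS hs₀ hSs₀ hD).trans ?_
    refine div_le_div_of_nonneg_right ?_ hlog.le
    have hDpos : (0 : ℝ) < ((p.1 - p.2).natAbs : ℝ) := by exact_mod_cast Nat.pos_of_ne_zero hD
    refine Real.log_le_log hDpos ?_
    have hcast : (((p.1 - p.2).natAbs : ℕ) : ℝ) = |((p.1 : ℝ) - p.2)| := by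
      rw [Nat.cast_natAbs, Int.cast_abs, Int.cast_sub]
    calc (((p.1 - p.2).natAbs : ℕ) : ℝ) = |((p.1 : ℝ) - p.2)| := hcast
      _ ≤ M := hM p.1 h1 p.2 h2
  calc (#(exceptional S T) : ℝ)
      ≤ #(T.offDiag.biUnion fun p => S.filter (· ∣ (p.1 - p.2).natAbs)) := by
        exact_mod_cast Finset.card_le_card hsub
    _ ≤ ∑ p ∈ T.offDiag, (#(S.filter (· ∣ (p.1 - p.2).natAbs)) : ℝ) := by
        exact_mod_cast Finset.card_biUnion_le
    _ ≤ ∑ p ∈ T.offDiag, Real.log M / Real.log s₀ := Finset.sum_le_sum hterm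
    _ = #T.offDiag * (Real.log M / Real.log s₀) := by
        rw [Finset.sum_const, nsmul_eq_mul]
    _ ≤ (#T : ℝ) ^ 2 * (Real.log M / Real.log s₀) := by
        have hoff : (#T.offDiag : ℝ) ≤ (#T : ℝ) ^ 2 := by
          rw [Finset.offDiag_card]
          have h := Nat.sub_le (#T * #T) #T
          calc ((#T * #T - #T : ℕ) : ℝ) ≤ ((#T * #T : ℕ) : ℝ) := by exact_mod_cast h
            _ = (#T : ℝ) ^ 2 := by push_cast; ring
        exact mul_le_mul_of_nonneg_right hoff hq

/-! ### `∏ (1 − t/s)` versus `σ^t` -/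

/-- Bernoulli: `1 − t/s ≤ (1 − 1/s)^t` for `s ≥ 1`; hence `∏_{s ∈ S} (1 − t/s) ≤ σ^t` with
`σ = ∏_{s ∈ S} (1 − 1/s)` (when the factors on the left are non-negative).
[cite: FordGreenKonyaginMaynardTao2018, Lemma 6.1 (proof, p. 18, second display)] -/
theorem prod_one_sub_div_le_pow {S : Finset ℕ} (hS : ∀ s ∈ S, 0 < s) (t : ℕ)
    (hT : ∀ s ∈ S, t ≤ s) :
    ∏ s ∈ S, (1 - (t : ℝ) / s) ≤ (∏ s ∈ S, (1 - (1 : ℝ) / s)) ^ t := by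
  rw [← Finset.prod_pow]
  refine Finset.prod_le_prod (fun s hs => ?_) (fun s hs => ?_)
  · have hs0 : (0 : ℝ) < s := by exact_mod_cast hS s hs
    rw [sub_nonneg, div_le_one hs0]
    exact_mod_cast hT s hs
  · have hs1 : (1 : ℝ) ≤ s := by exact_mod_cast hS s hs
    have h := one_add_le_pow_of_two_add_nonneg (a := -(1 : ℝ) / s)
      (by rw [neg_div]; have : (1 : ℝ) / s ≤ 1 := by rw [div_le_one (by linarith)]; exact hs1
          linarith) t
    calc 1 - (t : ℝ) / s = 1 + t * (-(1 : ℝ) / s) := by ring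
      _ ≤ (1 + -(1 : ℝ) / s) ^ t := h
      _ = (1 - (1 : ℝ) / s) ^ t := by rw [neg_div, ← sub_eq_add_neg]

/-- For `0 ≤ u ≤ 1/2`: `exp(−u) ≤ (1 − u) · exp(2u²)` (from `exp(−v) ≤ 1/(1 + v)` with
`v = u + 2u²` and `(1 − u)(1 + u + 2u²) = 1 + u²(1 − 2u) ≥ 1`). [folklore] -/
private theorem exp_neg_le_one_sub_mul_exp {u : ℝ} (hu0 : 0 ≤ u) (hu : u ≤ 1 / 2) :
    Real.exp (-u) ≤ (1 - u) * Real.exp (2 * u ^ 2) := by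
  have hv : 0 < 1 + (u + 2 * u ^ 2) := by positivity
  have h1 : Real.exp (-(u + 2 * u ^ 2)) ≤ 1 / (1 + (u + 2 * u ^ 2)) := by
    rw [Real.exp_neg, one_div]
    exact inv_anti₀ hv (by linarith [Real.add_one_le_exp (u + 2 * u ^ 2)])
  have h2 : 1 / (1 + (u + 2 * u ^ 2)) ≤ 1 - u := by
    rw [div_le_iff₀ hv]
    nlinarith [mul_nonneg (sq_nonneg u) (by linarith : (0 : ℝ) ≤ 1 - 2 * u)]
  have h3 : Real.exp (-u) = Real.exp (-(u + 2 * u ^ 2)) * Real.exp (2 * u ^ 2) := by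
    rw [← Real.exp_add]; ring_nf
  rw [h3]
  exact mul_le_mul_of_nonneg_right (h1.trans h2) (Real.exp_pos _).le

/-- `(1 − 1/s)^t ≤ (1 − t/s) · exp(2 t²/s²)` for `2t ≤ s` — the factor-wise form of
`(1 − 1/s)^t = (1 − t/s)(1 + O(t²/s²))`.
[cite: FordGreenKonyaginMaynardTao2018, Lemma 6.1 (proof, p. 18, second display)] -/
theorem pow_le_one_sub_div_mul_exp {s t : ℕ} (hs : 0 < s) (hts : 2 * t ≤ s) :
    (1 - (1 : ℝ) / s) ^ t ≤ (1 - (t : ℝ) / s) * Real.exp (2 * ((t : ℝ) / s) ^ 2) := by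
  have hs0 : (0 : ℝ) < s := by exact_mod_cast hs
  have hu0 : 0 ≤ (t : ℝ) / s := by positivity
  have hu : (t : ℝ) / s ≤ 1 / 2 := by
    rw [div_le_iff₀ hs0]
    have : (2 * t : ℝ) ≤ s := by exact_mod_cast hts
    linarith
  have h1 : (1 - (1 : ℝ) / s) ^ t ≤ Real.exp (-(1 : ℝ) / s) ^ t := by
    refine pow_le_pow_left₀ ?_ ?_ t
    · rw [sub_nonneg, div_le_one hs0]; exact_mod_cast hs
    · have := Real.add_one_le_exp (-(1 : ℝ) / s)
      rw [neg_div] at this ⊢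
      linarith
  have h2 : Real.exp (-(1 : ℝ) / s) ^ t = Real.exp (-((t : ℝ) / s)) := by
    rw [← Real.exp_nat_mul]; congr 1; ring
  rw [h2] at h1
  exact h1.trans (exp_neg_le_one_sub_mul_exp hu0 hu)

/-- `σ^t ≤ ∏_{s ∈ S} (1 − t/s) · exp(2 t² Σ_{s ∈ S} 1/s²)` when `2t ≤ s` for all moduli.
[cite: FordGreenKonyaginMaynardTao2018, Lemma 6.1 (proof, p. 18, last two displays)] -/
theorem pow_le_prod_one_sub_div_mul_exp {S : Finset ℕ} (hS : ∀ s ∈ S, 0 < s) (t : ℕ)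
    (hT : ∀ s ∈ S, 2 * t ≤ s) :
    (∏ s ∈ S, (1 - (1 : ℝ) / s)) ^ t ≤
      (∏ s ∈ S, (1 - (t : ℝ) / s)) * Real.exp (2 * (t : ℝ) ^ 2 * ∑ s ∈ S, 1 / (s : ℝ) ^ 2) := by
  rw [← Finset.prod_pow, Finset.mul_sum, Real.exp_sum, ← Finset.prod_mul_distrib]
  refine Finset.prod_le_prod (fun s hs => ?_) (fun s hs => ?_)
  · have hs0 : (0 : ℝ) < s := by exact_mod_cast hS s hs
    exact pow_nonneg (by rw [sub_nonneg, div_le_one hs0]; exact_mod_cast hS s hs) _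
  · refine (pow_le_one_sub_div_mul_exp (hS s hs) (hT s hs)).trans_eq ?_
    congr 2
    have hs0 : (s : ℝ) ≠ 0 := by exact_mod_cast (hS s hs).ne'
    field_simp

/-- Weierstrass product inequality: `1 − Σ_{s ∈ B} u_s ≤ ∏_{s ∈ B} (1 − u_s)` for `u_s ∈ [0, 1]`
(used with `u_s = t/s` to bound the discarded factors `∏_{s ∈ B} (1 − t/s) ≥ 1 − #B · t / s₀`).
[folklore] -/
private theorem one_sub_sum_le_prod_one_sub {ι : Type*} (B : Finset ι) (u : ι → ℝ)
    (hu0 : ∀ i ∈ B, 0 ≤ u i) (hu1 : ∀ i ∈ B, u i ≤ 1) :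
    1 - ∑ i ∈ B, u i ≤ ∏ i ∈ B, (1 - u i) := by
  classical
  induction B using Finset.induction_on with
  | empty => simp
  | insert a B ha ih =>
    rw [Finset.sum_insert ha, Finset.prod_insert ha]
    have ih' := ih (fun i hi => hu0 i (Finset.mem_insert_of_mem hi))
      (fun i hi => hu1 i (Finset.mem_insert_of_mem hi))
    have ha0 := hu0 a (Finset.mem_insert_self a B)
    have ha1 := hu1 a (Finset.mem_insert_self a B)
    have hP1 : ∏ i ∈ B, (1 - u i) ≤ 1 :=
      Finset.prod_le_one (fun i hi => by linarith [hu1 i (Finset.mem_insert_of_mem hi)])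
        (fun i hi => by linarith [hu0 i (Finset.mem_insert_of_mem hi)])
    -- (1 − u_a) P ≥ (1 − u_a)(1 − Σ) ≥ 1 − u_a − Σ  (as u_a Σ ≥ 0 … use P ≤ 1 instead)
    have : (1 - u a) * ∏ i ∈ B, (1 - u i) ≥ ∏ i ∈ B, (1 - u i) - u a := by
      nlinarith
    linarith

/-- The discarded factors: `∏_{s ∈ B} (1 − t/s) ≥ 1 − t · #B / s₀` if all `s ∈ B` are `≥ s₀ > 0` and
`t ≤ s₀`. [cite: FordGreenKonyaginMaynardTao2018, Lemma 6.1 (proof, p. 18, first display: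
`(1 + O(1/log^{19} x))^{O(log³ x)}`)] -/
theorem one_sub_le_prod_exceptional {B : Finset ℕ} {s₀ t : ℕ} (hs₀ : 0 < s₀)
    (hB : ∀ s ∈ B, s₀ ≤ s) (ht : t ≤ s₀) :
    1 - (t : ℝ) * #B / s₀ ≤ ∏ s ∈ B, (1 - (t : ℝ) / s) := by
  have hs₀' : (0 : ℝ) < s₀ := by exact_mod_cast hs₀
  have h1 : ∑ s ∈ B, (t : ℝ) / s ≤ (t : ℝ) * #B / s₀ := by
    calc ∑ s ∈ B, (t : ℝ) / s ≤ ∑ s ∈ B, (t : ℝ) / s₀ := by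
          refine Finset.sum_le_sum fun s hs => ?_
          have : (s₀ : ℝ) ≤ s := by exact_mod_cast hB s hs
          exact div_le_div_of_nonneg_left (Nat.cast_nonneg t) hs₀' this
      _ = (t : ℝ) * #B / s₀ := by
          rw [Finset.sum_const, nsmul_eq_mul]; ring
  have h2 := one_sub_sum_le_prod_one_sub B (fun s => (t : ℝ) / s)
    (fun s hs => by positivity)
    (fun s hs => by
      have hs' : (0 : ℝ) < s := by exact_mod_cast lt_of_lt_of_le hs₀ (hB s hs)
      rw [div_le_one hs']
      exact_mod_cast ht.trans (hB s hs))
  linarith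

end FGKMT2018

end Literature.NumberTheory.Sieve
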